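import Summits.HodgeConjecture.HodgeConjecture.Theorems.MarkmanPartnerTransportHodgeClassesModKappaClassesAnyDegree

/-!
# Route MarkmanPartnerTransport · crux #5 `LowPicardRealMultiplication` — «RM-EXACT»: an RM generator of degree
# `d ≥ 2` EXCLUDES `SpannedByIsometries` (so `¬ SpannedByIsometries ⟺ ∃ d ≥ 2, RMgen`)

Programme «RM-GEN + CELL-SPLIT» (planner p1 g38, ASSIGN «RM-EXACT» 14:38Z): the converse of «RM-GEN»
(`exists_rmGenerator_of_not_spannedByIsometries`, `…LowPicardRMCells`), making the six-cell decomposition of crux #5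
LOSSLESS. Route-independent (no `Theses` import; notations copied verbatim); the `iff` is appended to
`…LowPicardRMCells`, the only file of the programme importing the route file.

* `not_spannedByIsometries_of_rmGenerator` — for a marked smooth projective `(X, φ, P, z)` (no `K3^{[2]}`-type
  hypothesis needed) and `RMgen[X, φ, z, d]` with `d ≥ 2`, `¬ SpIso[X, φ]`.

Proof (elementary — no Zarhin, no period datum). `σ := φ⁻¹z` and `σ̄ := φ⁻¹z̄` lie in the `T`-domain
`{y : q(φy, φN¹) = 0}` ((m5) and `N¹ ⊂ H^{1,1}`), and `q(z, z̄) ≠ 0` ((m6)). With a transcendental projector `π_T`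
(`exists_transcendentalProjector`) the endomorphism `f := θ ∘ π_T` is rational, type-preserving, kills `N¹` and
has `q`-transcendental image (`θ` is `q`-self-adjoint and preserves `N¹`). If `SpIso` held, `f = Σ cᵢ gᵢ` on the
`T`-domain with `gᵢ` rational type-preserving `q`-isometries: (i) `gᵢσ = tᵢσ`; (ii) GEN: `gᵢ = Σⱼ aᵢⱼ θʲ` on the
`T`-domain, so `tᵢ = Σⱼ aᵢⱼ evʲ` and `gᵢσ̄ = Σⱼ aᵢⱼ θʲσ̄`; (iii) isometry at `(σ, σ̄)` with `θʲ` self-adjoint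
(`k3HilbertForm_pow_selfAdjoint`): `tᵢ² q(z,z̄) = q(z,z̄)`, so `tᵢ = ±1`; (iv) `f σ = θσ = ev·σ = (Σ cᵢtᵢ)σ`, so
`ev ∈ ℚ` and `minpoly_ℚ(ev) = X − C` has degree `1 < 2 ≤ d`. No definition, no sorry, no named-fact hypothesis.
Prover seat hodge-nonav-20241-p1 (gen 14), `--supports stmt-HodgeConjecture-19653`. Nothing here proves the crux or HC.

References: Yu. Zarhin, J. reine angew. Math. 341 (1983) Thm. 1.5.1 (context); D. Huybrechts, *Lectures on K3
Surfaces*, Ch. 3 §3.3; B. van Geemen, Michigan Math. J. 56 (2008) Lemma 3.2.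
-/

noncomputable section

set_option linter.dupNamespace false

open Module CategoryTheory Polynomial
open Literature.AlgebraicTopology.SingularHomology Literature.Geometry.Kaehler
open Literature.AlgebraicGeometry Literature.AlgebraicGeometry.Motives Literature.AlgebraicGeometry.HodgeTheory
open Literature.AlgebraicGeometry.Hyperkaehler Literature.AlgebraicGeometry.Surfaces
open Summit.HodgeConjecture.HodgeConjecture.Theorems.NikulinTwinTransport
open Summit.HodgeConjecture.HodgeConjecture.Theorems.MarkmanPartnerTransport.BBFPositivity

namespace Summit.HodgeConjecture.HodgeConjecture.Theorems.MarkmanPartnerTransport.PartnerLattice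

/-- `MarkedK3Sq[X, φ, P, z]`: VERBATIM the `let MarkedK3Sq := …` binder of the route declarations of
MarkmanPartnerTransport (clauses (m1)–(m6)). Local notation only. -/
local notation3 (prettyPrint := false) "MarkedK3Sq[" X ", " φ ", " P ", " z "]" =>
  (((IsIntegralClass P ∧ ∀ Q : complexBetti X (2 * 4), IsIntegralClass Q → ∃ n : ℤ, Q = n • P) ∧
    (∀ c : complexBetti X 2, IsIntegralClass c ↔ ∃ v : K3HilbertIndex → ℤ, φ c = fun i => (v i : ℂ)) ∧
    (∀ a : complexBetti X 2, cupPowTwo a 4 = ((3 : ℂ) * (k3HilbertForm 2 (φ a) (φ a)) ^ 2) • P) ∧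
    (IsOfHodgeType 4 X 2 2 0 (LinearEquiv.symm φ z) ∧
      ∀ τ : complexBetti X 2, IsOfHodgeType 4 X 2 2 0 τ → ∃ t : ℂ, τ = t • LinearEquiv.symm φ z) ∧
    (∀ c : complexBetti X 2, IsOfHodgeType 4 X 2 1 1 c ↔
      (k3HilbertForm 2 (φ c) z = 0 ∧ k3HilbertForm 2 (φ c) (star z) = 0)) ∧
    (k3HilbertForm 2 z z = 0 ∧ 0 < (k3HilbertForm 2 (star z) z).re)))

/-- `SpIso[X, φ]`: VERBATIM the `let SpannedByIsometries := …` binder of the route declarations (with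
`IsBBFTransc` unfolded). Local notation only. -/
local notation3 (prettyPrint := false) "SpIso[" X ", " φ "]" =>
  (∀ f : complexBetti X 2 →ₗ[ℂ] complexBetti X 2, (∀ y, IsRationalClass y → IsRationalClass (f y)) →
    (∀ (i j : ℕ) y, IsOfHodgeType 4 X 2 i j y → IsOfHodgeType 4 X 2 i j (f y)) →
    (∀ d : complexBetti X 2, d ∈ algebraicClasses X 1 → f d = 0) →
    (∀ y : complexBetti X 2, ∀ d : complexBetti X 2, d ∈ algebraicClasses X 1 →
      k3HilbertForm 2 (φ (f y)) (φ d) = 0) →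
    ∃ (k : ℕ) (c : Fin k → ℚ) (g : Fin k → (complexBetti X 2 →ₗ[ℂ] complexBetti X 2)),
      (∀ i, Function.Bijective (g i) ∧ (∀ y, IsRationalClass y → IsRationalClass (g i y)) ∧
        (∀ (a b : ℕ) y, IsOfHodgeType 4 X 2 a b y → IsOfHodgeType 4 X 2 a b (g i y)) ∧
        (∀ a b, k3HilbertForm 2 (φ (g i a)) (φ (g i b)) = k3HilbertForm 2 (φ a) (φ b))) ∧
      ∀ y : complexBetti X 2, (∀ d : complexBetti X 2, d ∈ algebraicClasses X 1 →
        k3HilbertForm 2 (φ y) (φ d) = 0) → f y = ∑ i : Fin k, ((c i : ℂ) • g i y))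

/-- `RMgen[X, φ, z, d]` («RMgen» data, the `RMGenData` of Sketch P1AK-CELLS with self-adjointness added): a
rational, type-preserving, `q`-self-adjoint endomorphism `θ` of `H²(X(ℂ); ℂ)` with `θ σ = ev · σ`, `ev` real,
`deg minpoly_ℚ(ev) = d`, `d · n + ρ(X) = 23` for some `n ≥ 3`, and GEN: every rational type-preserving endomorphism
is `Σ_{i<d} cᵢ θⁱ` (`cᵢ ∈ ℚ`) on `T(X)_ℂ = {y : q(φ y, φ N¹(X)) = 0}`. Local notation only. -/
local notation3 (prettyPrint := false) "RMgen[" X ", " φ ", " z ", " d "]" =>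
  (∃ θ : complexBetti X 2 →ₗ[ℂ] complexBetti X 2, (∀ y, IsRationalClass y → IsRationalClass (θ y)) ∧
    (∀ (i j : ℕ) y, IsOfHodgeType 4 X 2 i j y → IsOfHodgeType 4 X 2 i j (θ y)) ∧
    (∀ y w : complexBetti X 2, k3HilbertForm 2 (φ (θ y)) (φ w) = k3HilbertForm 2 (φ y) (φ (θ w))) ∧
    ∃ ev : ℂ, θ (LinearEquiv.symm φ z) = ev • LinearEquiv.symm φ z ∧ ev.im = 0 ∧
      (minpoly ℚ ev).natDegree = d ∧
      (∃ n : ℕ, 3 ≤ n ∧ d * n + Module.finrank ℂ ↥(algebraicClasses X 1) = 23) ∧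
      ∀ f : complexBetti X 2 →ₗ[ℂ] complexBetti X 2, (∀ y, IsRationalClass y → IsRationalClass (f y)) →
        (∀ (i j : ℕ) y, IsOfHodgeType 4 X 2 i j y → IsOfHodgeType 4 X 2 i j (f y)) →
        ∃ c : Fin d → ℚ, ∀ y : complexBetti X 2,
          (∀ a : complexBetti X 2, a ∈ algebraicClasses X 1 → k3HilbertForm 2 (φ y) (φ a) = 0) →
            f y = ∑ i : Fin d, ((c i : ℂ) • (θ ^ (i : ℕ)) y))

variable {X : SchemeOver ℂ} {φ : complexBetti X 2 ≃ₗ[ℂ] (K3HilbertIndex → ℂ)} {P : complexBetti X (2 * 4)}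
  {z : K3HilbertIndex → ℂ}

/-- Powers act on an eigenvector by powers of the eigenvalue. [folklore] -/
theorem pow_apply_of_eigen (θ : complexBetti X 2 →ₗ[ℂ] complexBetti X 2) {σ : complexBetti X 2} {ev : ℂ}
    (h : θ σ = ev • σ) : ∀ k : ℕ, (θ ^ k) σ = ev ^ k • σ := by
  intro k
  induction k with
  | zero => rw [pow_zero, pow_zero, Module.End.one_apply, one_smul]
  | succ k ih => rw [pow_succ', Module.End.mul_apply, ih, map_smul, h, smul_smul, pow_succ, mul_comm]

/-- `q(φ w, φ (Σᵢ uᵢ • vᵢ)) = Σᵢ uᵢ · q(φ w, φ vᵢ)` (right-argument version of `k3HilbertForm_sum_smul_left`).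
[folklore] -/
theorem k3HilbertForm_sum_smul_right (φ : complexBetti X 2 ≃ₗ[ℂ] (K3HilbertIndex → ℂ)) {ι : Type*}
    (s : Finset ι) (u : ι → ℂ) (v : ι → complexBetti X 2) (w : complexBetti X 2) :
    k3HilbertForm 2 (φ w) (φ (∑ i ∈ s, u i • v i)) = ∑ i ∈ s, u i * k3HilbertForm 2 (φ w) (φ (v i)) := by
  rw [k3HilbertForm_comm, k3HilbertForm_sum_smul_left]
  exact Finset.sum_congr rfl fun i _ => by rw [k3HilbertForm_comm]

/-- **«RM-EXACT»: an RM generator of degree `d ≥ 2` excludes `SpannedByIsometries`** (module docstring): for a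
marked smooth projective `(X, φ, P, z)` and `RMgen[X, φ, z, d]` with `2 ≤ d`, `¬ SpIso[X, φ]`. With «RM-GEN» this
is `¬ SpannedByIsometries ⟺ ∃ d ≥ 2, RMgen` (`not_spannedByIsometries_iff_exists_rmGenerator`, `…LowPicardRMCells`).
[cite: Zarhin1983HodgeGroupsK3, Thm. 1.5.1] [cite: Huybrechts2016K3, Ch. 3 §3.3] -/
theorem not_spannedByIsometries_of_rmGenerator (hX : IsSmoothProjective 4 X) (hM : MarkedK3Sq[X, φ, P, z])
    {d : ℕ} (hd : 2 ≤ d) (hR : RMgen[X, φ, z, d]) : ¬ SpIso[X, φ] := by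
  classical
  intro hsp
  obtain ⟨-, hint, -, ⟨hz20, hz20'⟩, h11, hzz, hzpos⟩ := id hM
  obtain ⟨θ, h1, h2, h5, ev, hev, -, hdeg, -, hG⟩ := hR
  -- `σ`, `σ̄` and the `T`-domain
  have hzne : z ≠ 0 := by
    intro h0
    rw [h0, k3HilbertForm_eq_dotProduct] at hzpos
    simp at hzpos
  have hσne : (LinearEquiv.symm φ z) ≠ 0 := fun h => hzne (by simpa using congrArg φ h)
  have hq0 : k3HilbertForm 2 z (star z) ≠ 0 := by
    intro h0
    rw [k3HilbertForm_comm] at h0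
    rw [h0, Complex.zero_re] at hzpos
    exact lt_irrefl _ hzpos
  have hN11 : ∀ d ∈ algebraicClasses X 1, IsOfHodgeType 4 X 2 1 1 d := fun d hd =>
    isOfHodgeType_of_mem_algebraicClasses_of_isSmoothProjective hX 1 hd
  have hσT : ∀ a ∈ algebraicClasses X 1, k3HilbertForm 2 (φ (LinearEquiv.symm φ z)) (φ a) = 0 := by
    intro a ha
    rw [LinearEquiv.apply_symm_apply, k3HilbertForm_comm]
    exact ((h11 a).1 (hN11 a ha)).1
  have hσ'T : ∀ a ∈ algebraicClasses X 1, k3HilbertForm 2 (φ (LinearEquiv.symm φ (star z))) (φ a) = 0 := by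
    intro a ha
    rw [LinearEquiv.apply_symm_apply, k3HilbertForm_comm]
    exact ((h11 a).1 (hN11 a ha)).2
  -- powers of `θ`: self-adjoint, eigenvalues `evᵏ` on `σ`
  have hPadj := k3HilbertForm_pow_selfAdjoint φ θ h5
  have hPσ := pow_apply_of_eigen θ hev
  -- `θ` preserves `N¹`
  have hθN : ∀ a ∈ algebraicClasses X 1, θ a ∈ algebraicClasses X 1 :=
    map_mem_algebraicClasses_one_of_rational_hodge hX θ h1 (h2 1 1)
  -- `f := θ ∘ π_T`
  obtain ⟨πT, hT1, hT2, hT3, -, hT5, -, hT7⟩ := exists_transcendentalProjector hX hM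
  obtain ⟨k, c, g, hg, hf⟩ := hsp (θ ∘ₗ πT)
    (fun y hy => by rw [LinearMap.comp_apply]; exact h1 _ (hT5 _ hy))
    (fun i j y hy => by rw [LinearMap.comp_apply]; exact h2 i j _ (hT7 i j _ hy))
    (fun a ha => by rw [LinearMap.comp_apply, hT1 a ha, map_zero])
    (fun y a ha => by rw [LinearMap.comp_apply, h5]; exact hT3 y _ (hθN a ha))
  -- (i) `gᵢ σ = tᵢ σ`
  have ht : ∀ i : Fin k, ∃ t : ℂ, g i (LinearEquiv.symm φ z) = t • LinearEquiv.symm φ z :=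
    fun i => hz20' _ ((hg i).2.2.1 2 0 _ hz20)
  choose t ht using ht
  -- (ii) GEN for `gᵢ`: `gᵢ = Σⱼ aᵢⱼ θʲ` on the `T`-domain, `tᵢ = Σⱼ aᵢⱼ evʲ`
  have ha : ∀ i : Fin k, ∃ a : Fin d → ℚ, ∀ y : complexBetti X 2,
      (∀ b : complexBetti X 2, b ∈ algebraicClasses X 1 → k3HilbertForm 2 (φ y) (φ b) = 0) →
        g i y = ∑ j : Fin d, ((a j : ℂ) • (θ ^ (j : ℕ)) y) :=
    fun i => hG (g i) (hg i).2.1 (hg i).2.2.1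
  choose a ha using ha
  have htev : ∀ i : Fin k, t i = ∑ j : Fin d, (a i j : ℂ) * ev ^ (j : ℕ) := by
    intro i
    have h := ha i _ hσT
    rw [ht i] at h
    simp_rw [hPσ, smul_smul] at h
    rw [← Finset.sum_smul] at h
    exact smul_left_injective ℂ hσne h
  -- (iii) isometry at `(σ, σ̄)`: `tᵢ² = 1`
  have hsq : ∀ i : Fin k, t i * t i = 1 := by
    intro i
    have hiso := (hg i).2.2.2 (LinearEquiv.symm φ z) (LinearEquiv.symm φ (star z))
    rw [ht i, ha i _ hσ'T, map_smul, k3HilbertForm_smul_left, k3HilbertForm_sum_smul_right,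
      LinearEquiv.apply_symm_apply, LinearEquiv.apply_symm_apply] at hiso
    have hj : ∀ j : Fin d, k3HilbertForm 2 z (φ ((θ ^ (j : ℕ)) (LinearEquiv.symm φ (star z)))) =
        ev ^ (j : ℕ) * k3HilbertForm 2 z (star z) := by
      intro j
      have h := hPadj j (LinearEquiv.symm φ (star z)) (LinearEquiv.symm φ z)
      rw [hPσ, map_smul, LinearEquiv.apply_symm_apply, LinearEquiv.apply_symm_apply, k3HilbertForm_smul_right,
        k3HilbertForm_comm 2 (star z) z] at h
      rw [k3HilbertForm_comm]
      exact h
    simp_rw [hj, ← mul_assoc] at hiso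
    rw [← Finset.sum_mul, ← htev, ← mul_assoc] at hiso
    have h1' : t i * t i * k3HilbertForm 2 z (star z) = 1 * k3HilbertForm 2 z (star z) := by rw [hiso, one_mul]
    exact mul_right_cancel₀ hq0 h1'
  have hpm : ∀ i : Fin k, t i = 1 ∨ t i = -1 := fun i => mul_self_eq_one_iff.1 (hsq i)
  -- (iv) `ev = Σ cᵢ tᵢ ∈ ℚ`
  obtain ⟨s, hs⟩ : ∃ s : Fin k → ℚ, ∀ i, t i = (s i : ℂ) := by
    refine ⟨fun i => if t i = 1 then 1 else -1, fun i => ?_⟩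
    dsimp only
    split_ifs with h
    · rw [h, Rat.cast_one]
    · rcases hpm i with h' | h'
      · exact absurd h' h
      · rw [h', Rat.cast_neg, Rat.cast_one]
  have hevq : ev = ((∑ i : Fin k, c i * s i : ℚ) : ℂ) := by
    have h := hf (LinearEquiv.symm φ z) hσT
    rw [LinearMap.comp_apply, hT2 _ hσT, hev] at h
    simp_rw [ht, smul_smul] at h
    rw [← Finset.sum_smul] at h
    have h' := smul_left_injective ℂ hσne h
    rw [h']
    push_cast
    exact Finset.sum_congr rfl fun i _ => by rw [hs i]
  -- `minpoly_ℚ(ev) = X − C`, degree `1 < 2 ≤ d`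
  have hmin : (minpoly ℚ ev).natDegree = 1 := by
    rw [hevq, show ((∑ i : Fin k, c i * s i : ℚ) : ℂ) = algebraMap ℚ ℂ (∑ i : Fin k, c i * s i) from
      (eq_ratCast _ _).symm, minpoly.eq_X_sub_C ℂ, Polynomial.natDegree_X_sub_C]
  omega

end Summit.HodgeConjecture.HodgeConjecture.Theorems.MarkmanPartnerTransport.PartnerLattice

end
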